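import Summits.HubbardSuperconductivity.HubbardSuperconductivity.Theorems.TwTipContinuation.Negative.SeededChords
import Literature.MathematicalPhysics.QuantumLattice.ApproximatingHamiltonianProofs
import Literature.MathematicalPhysics.QuantumLattice.DWaveSourceProofs
import Literature.MathematicalPhysics.QuantumLattice.LiebFluxPhaseProofs

/-!
# Route `ThermalWedge` — structural (route-file-free) engine of the ANCHOR `TwSeededRung`
(stmt-HubbardSuperconductivity-1699)

This module deliberately does NOT import `Summits/…/Theses/ThermalWedge.lean` (nor any module that
does), so that a closing theorem built on it can be linked into the route file as
`TwSeededRung_holds` without an import cycle (cf. the dropped links recorded at the top of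
`Theses/ThermalWedge.lean`). Statements are therefore written with the VERBATIM BODIES of the route
declarations:

  `twSeededRung_structural : ⟦TwSeededEnsembleEquivalence, narrowed to β ≤ e^{a/U}⟧ →
      ⟦TwSourcedCondensation⟧ → ⟦TwSeededRung⟧`.

The first hypothesis is the NARROWING of the crux `TwSeededEnsembleEquivalence` recommended by its
standing disprover (`Cruxes/TwSeededEnsembleEquivalence/Disproof.lean`, `CruxNarrow`: the entropy
allowance is only asked for `1 ≤ β ≤ e^{a/U}`, for every `a > 0`, with `U₀ = U₀(δ,a)` and the
`μ`-window chosen BEFORE `a`); the crux as filed implies it by dropping the cap on `β`, so the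
engine serves both the present and the narrowed route. The companion module
`ThermalWedgeTwSeededRung.lean` (imports the route file) states the same result against the route's
declarations (`twSeededRung_of_condensation`).

Mechanism (rung chord from the PURE model, `g' = 0`): for a normalised sector ground state `ψ` of
`H_L(U,g) = hubbardTorus 2 L 1 U − (g/L²)·P_L`,
`(g/L²)⟨ψ,P_Lψ⟩ ≥ E_L(0) − E_L(g)` (`leftChord_le_order`);
`E_L(0)/L² ≥ μN_L/L² − p_L(β,μ,U,0)` (Gibbs bound on a sector ground state: keep the ground term of
`Z` and use the variational principle — `twr_sectorEnergy_zero_ge`);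
`E_L(g)/L² ≤ μN_L/L² − p_L(β,μ,U,g) + log4/β + ε` (ensemble equivalence, at its `μ ∈ [μ₁,μ₂]`);
`p_L(g) ≥ p̃_L(s) − s²/g` (approximating Hamiltonian, easy half: completed square + monotonicity of
the free energy — `twr_sourcedPressure_le_seededPressure_add`, Bru–Pedra 2013 App. Thm 107);
`p̃_L(s) − p̃_L(0) ≥ c s² log(1/(|s|+1/β)) − C s²` (condensation). Constants: `β = e^{a/U}`,
`s = e^{-a/(4U)}`, `ε = c a s²/(32U)`, `K = 16/(ca)`,
`U₀ = min {U₀ᵉ(a), U₀ᶜ, 1/(20K), a h₀/4, ca/(32(c log 2 + C + log 4))}`, output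
`c(U,g) = c a s²/(8Ug)`.
-/

namespace Summit.HubbardSuperconductivity.HubbardSuperconductivity.Theorems

open Literature.MathematicalPhysics.QuantumLattice Matrix
open Summit.HubbardSuperconductivity.TwTipContinuation.Negative
open scoped ComplexOrder Matrix.Norms.L2Operator

section Ingredients

variable (L : ℕ) [NeZero L]

/-- **Approximating-Hamiltonian theorem, easy half** (pressure form, every `L`, `β > 0`, `g > 0`):
`p̃_L(β,μ,U,h) ≤ p_L(β,μ,U,g) + h²/g` for every real source `h` — from the completed square
`H_{L,h} + (h²L²/g)·1 − (hubbardTorusWith − (g/L²)ΔᴴΔ) = (g/L²)(Δ − hL²/g)ᴴ(Δ − hL²/g) ≥ 0`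
(`log_partitionFn_approx_le_model` with channel `√g·Δ`, `c = h/√g`, volume `L²`).
[cite: BruPedra2013, Appendix: The approximating Hamiltonian method, Theorem 107 (lower bound)] -/
theorem twr_sourcedPressure_le_seededPressure_add (U μ : ℝ) {β g : ℝ} (hβ : 0 < β) (hg : 0 < g)
    (h : ℝ) :
    Real.log (partitionFn β (dWaveSourceTorus L U μ h)).re / (β * (L : ℝ) ^ 2) ≤
      Real.log (partitionFn β (hubbardTorusWith 2 L 1 U μ - ((g / (L : ℝ) ^ 2 : ℝ) : ℂ) •
        ((pairField dWaveFormFactor L)ᴴ * pairField dWaveFormFactor L))).re /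
          (β * (L : ℝ) ^ 2) + h ^ 2 / g := by
  have hL : (0 : ℝ) < (L : ℝ) ^ 2 := by
    have := NeZero.pos L
    positivity
  have hβL : 0 < β * (L : ℝ) ^ 2 := mul_pos hβ hL
  have hsg : 0 < Real.sqrt g := Real.sqrt_pos.2 hg
  have key := log_partitionFn_approx_le_model (isHermitian_hubbardTorusWith L 1 U μ)
    ((Real.sqrt g : ℂ) • pairField dWaveFormFactor L) hβ.le hL ((h / Real.sqrt g : ℝ) : ℂ)
  have e1 : hubbardTorusWith 2 L 1 U μ -
      (starRingEnd ℂ ((h / Real.sqrt g : ℝ) : ℂ) • ((Real.sqrt g : ℂ) • pairField dWaveFormFactor L) +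
        ((h / Real.sqrt g : ℝ) : ℂ) • ((Real.sqrt g : ℂ) • pairField dWaveFormFactor L)ᴴ) =
      dWaveSourceTorus L U μ h := by
    have hc : ((h / Real.sqrt g : ℝ) : ℂ) * (Real.sqrt g : ℂ) = (h : ℂ) := by
      push_cast
      field_simp
    rw [Complex.conj_ofReal, conjTranspose_smul, smul_smul, smul_smul, Complex.star_def,
      Complex.conj_ofReal, hc, dWaveSourceTorus, smul_add]
  have e2 : hubbardTorusWith 2 L 1 U μ - ((((L : ℝ) ^ 2)⁻¹ : ℝ) : ℂ) •
      (((Real.sqrt g : ℂ) • pairField dWaveFormFactor L)ᴴ *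
        ((Real.sqrt g : ℂ) • pairField dWaveFormFactor L)) =
      hubbardTorusWith 2 L 1 U μ - ((g / (L : ℝ) ^ 2 : ℝ) : ℂ) •
        ((pairField dWaveFormFactor L)ᴴ * pairField dWaveFormFactor L) := by
    have hgg : (Real.sqrt g : ℂ) * (Real.sqrt g : ℂ) = (g : ℂ) := by
      rw [← Complex.ofReal_mul, Real.mul_self_sqrt hg.le]
    rw [conjTranspose_smul, Complex.star_def, Complex.conj_ofReal, smul_mul_smul_comm, hgg,
      smul_smul]
    congr 2
    push_cast
    field_simp
  have e3 : ‖((h / Real.sqrt g : ℝ) : ℂ)‖ ^ 2 = h ^ 2 / g := by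
    rw [Complex.norm_real, Real.norm_eq_abs, sq_abs, div_pow, Real.sq_sqrt hg.le]
  rw [e1, e2, e3] at key
  have key' := div_le_div_of_nonneg_right key hβL.le
  rw [sub_div, mul_div_cancel_left₀ _ hβL.ne'] at key'
  linarith

/-- **Gibbs lower bound on the pure sector energy** (the trivial half of the one-point Legendre
inequality, intensive form, at `g = 0`): for `n ≤ |Λ_L|`, every `μ` and every `β > 0`,
`μ·2n/L² − log Re Z(β, hubbardTorusWith 2 L 1 U μ)/(βL²) ≤ E_L(0)/L²`, where `E_L(0)` is the sector
energy of `hubbardTorus − (0/L²)•P_L` in the sector `(2n, S^z = 0)`: keep the ground term of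
`Z = Σ e^{-βλ}`, bound `λ_min` by the Rayleigh quotient of a normalised sector ground state `ψ₀`,
and use `N̂ψ₀ = 2n·ψ₀`. [folklore] -/
theorem twr_sectorEnergy_zero_ge (U μ : ℝ) {β : ℝ} (hβ : 0 < β) {n : ℕ}
    (hn : n ≤ Fintype.card (FermionTorus 2 L)) :
    μ * ((2 * n : ℕ) : ℝ) / (L : ℝ) ^ 2 -
        Real.log (partitionFn β (hubbardTorusWith 2 L 1 U μ)).re / (β * (L : ℝ) ^ 2) ≤
      Matrix.minEnergyOn (hubbardTorus 2 L 1 U - ((0 / (L : ℝ) ^ 2 : ℝ) : ℂ) •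
        ((pairField dWaveFormFactor L)ᴴ * pairField dWaveFormFactor L)) (szSector (2 * n) 0) /
          (L : ℝ) ^ 2 := by
  obtain ⟨ψ₀, hψ₀, hgs₀⟩ := exists_unit_groundState U 0 L hn
  have hN : IsNParticle (2 * n) ψ₀ := ((mem_szSector_iff _ _ ψ₀).1 hgs₀.1).1
  have hH : (hubbardTorusWith 2 L 1 U μ).IsHermitian := isHermitian_hubbardTorusWith L 1 U μ
  have hL : (0 : ℝ) < (L : ℝ) ^ 2 := by
    have := NeZero.pos L
    positivity
  -- keep the ground term of `Z`, then the variational principle on `ψ₀`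
  have h1 := exp_neg_mul_groundEnergy_le_partitionFn hH β
  have h2 : (hubbardTorusWith 2 L 1 U μ).groundEnergy ≤
      (star ψ₀ ⬝ᵥ (hubbardTorusWith 2 L 1 U μ) *ᵥ ψ₀).re := groundEnergy_le_rayleigh_holds hH ψ₀ hψ₀
  have h3 : -(β * (star ψ₀ ⬝ᵥ (hubbardTorusWith 2 L 1 U μ) *ᵥ ψ₀).re) ≤
      Real.log (partitionFn β (hubbardTorusWith 2 L 1 U μ)).re := by
    have h4 : Real.exp (-(β * (star ψ₀ ⬝ᵥ (hubbardTorusWith 2 L 1 U μ) *ᵥ ψ₀).re)) ≤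
        (partitionFn β (hubbardTorusWith 2 L 1 U μ)).re :=
      (Real.exp_le_exp.2 (by nlinarith)).trans h1
    calc -(β * (star ψ₀ ⬝ᵥ (hubbardTorusWith 2 L 1 U μ) *ᵥ ψ₀).re)
        = Real.log (Real.exp (-(β * (star ψ₀ ⬝ᵥ (hubbardTorusWith 2 L 1 U μ) *ᵥ ψ₀).re))) :=
          (Real.log_exp _).symm
      _ ≤ _ := Real.log_le_log (Real.exp_pos _) h4
  -- `Re⟨ψ₀, (H − μN̂)ψ₀⟩ = E_L(0) − μ·2n`
  have h5 : (star ψ₀ ⬝ᵥ (hubbardTorusWith 2 L 1 U μ) *ᵥ ψ₀).re =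
      Matrix.minEnergyOn (hubbardTorus 2 L 1 U - ((0 / (L : ℝ) ^ 2 : ℝ) : ℂ) •
        ((pairField dWaveFormFactor L)ᴴ * pairField dWaveFormFactor L)) (szSector (2 * n) 0) -
        μ * ((2 * n : ℕ) : ℝ) := by
    have heq : hubbardTorusWith 2 L 1 U μ =
        (hubbardTorus 2 L 1 U - ((0 / (L : ℝ) ^ 2 : ℝ) : ℂ) •
          ((pairField dWaveFormFactor L)ᴴ * pairField dWaveFormFactor L)) -
          (μ : ℂ) • totalNumber := by
      rw [seededH_zero, hubbardTorusWith_eq]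
    have hE := expect_eq_of_groundState L hψ₀ hgs₀
    rw [Literature.MathematicalPhysics.QuantumLattice.expect] at hE
    rw [heq, sub_mulVec, smul_mulVec, totalNumber_mulVec_of_isNParticle hN, smul_smul,
      dotProduct_sub, dotProduct_smul, hψ₀, hE, Complex.sub_re, Complex.ofReal_re, smul_eq_mul,
      mul_one]
    simp
  rw [h5] at h3
  -- divide by `βL²`
  have h6 : μ * ((2 * n : ℕ) : ℝ) - Real.log (partitionFn β (hubbardTorusWith 2 L 1 U μ)).re / β ≤
      Matrix.minEnergyOn (hubbardTorus 2 L 1 U - ((0 / (L : ℝ) ^ 2 : ℝ) : ℂ) •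
        ((pairField dWaveFormFactor L)ᴴ * pairField dWaveFormFactor L)) (szSector (2 * n) 0) := by
    rw [sub_le_iff_le_add, ← sub_le_iff_le_add', le_div_iff₀ hβ]
    linarith
  have h7 := div_le_div_of_nonneg_right h6 hL.le
  rwa [sub_div, div_div] at h7

end Ingredients

section Bookkeeping

/-- The real-arithmetic core of the rung from the pure model: chord + Gibbs lower bound at `g = 0`
+ ensemble equivalence at `g` + approximating Hamiltonian (easy half) + condensation give
`(m/g)·L⁴ ≤ ⟨P⟩` for any margin `m` with `m + s²/g + log4/β + ε ≤ X`. [folklore] -/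
theorem twr_bookkeeping {E₀ E P p₀ pg ph n L g lb ε X m hsq : ℝ} (hL : 0 < L) (hg : 0 < g)
    (hchord : E₀ - E ≤ (g - 0) / L ^ 2 * P) (hlow : n - p₀ ≤ E₀ / L ^ 2)
    (hup : E / L ^ 2 + pg - n ≤ lb + ε) (hahm : ph ≤ pg + hsq) (hcond : X ≤ ph - p₀)
    (hm : m + hsq + lb + ε ≤ X) : m / g * L ^ 4 ≤ P := by
  have hL2 : 0 < L ^ 2 := by positivity
  have hL4 : 0 < L ^ 4 := by positivity
  have h1 : m ≤ (E₀ - E) / L ^ 2 := by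
    rw [sub_div]
    linarith
  have h2 : (E₀ - E) / L ^ 2 ≤ (g - 0) / L ^ 2 * P / L ^ 2 :=
    div_le_div_of_nonneg_right hchord hL2.le
  have h3 : (g - 0) / L ^ 2 * P / L ^ 2 = g * P / L ^ 4 := by
    field_simp
    ring
  rw [h3] at h2
  have h4 : m * L ^ 4 ≤ g * P := by
    have := h1.trans h2
    rwa [le_div_iff₀ hL4] at this
  rw [div_mul_eq_mul_div, div_le_iff₀ hg]
  linarith

/-- The margin at the probe source `s = e^{-a/(4U)}`, temperature `β⁻¹ = e^{-a/U}` and allowance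
`ε = c a s²/(32U)`: once `1/g ≤ c a/(16U)` and `c log 2 + C + log 4 ≤ c a/(32U)`,
`c a s²/(8U) + s²/g + log4/β + ε ≤ c s² log(1/(|s| + 1/β)) − C s²`. [folklore] -/
theorem twr_margin {a c C U g β s ε : ℝ} (ha : 0 < a) (hc : 0 < c) (hU : 0 < U)
    (hβ : β = Real.exp (a / U)) (hs : s = Real.exp (-(a / (4 * U))))
    (hginv : 1 / g ≤ c * a / (16 * U))
    (hsmall : c * Real.log 2 + C + Real.log 4 ≤ c * a / (32 * U))
    (hε : ε = c * a / (32 * U) * s ^ 2) :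
    c * a * s ^ 2 / (8 * U) + s ^ 2 / g + Real.log 4 / β + ε ≤
      c * s ^ 2 * Real.log (1 / (|s| + 1 / β)) - C * s ^ 2 := by
  have hspos : 0 < s := by rw [hs]; exact Real.exp_pos _
  have hx : 0 < a / (4 * U) := by positivity
  have hs1 : s ≤ 1 := by
    rw [hs]
    exact Real.exp_le_one_iff.2 (by linarith)
  have hs2 : 0 < s ^ 2 := by positivity
  have hT : 1 / β = Real.exp (-(a / U)) := by rw [hβ, Real.exp_neg, one_div]
  have hss : s ^ 2 = Real.exp (-(a / (2 * U))) := by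
    rw [hs, sq, ← Real.exp_add]
    congr 1
    field_simp
    ring
  have hTs2 : 1 / β ≤ s ^ 2 := by
    rw [hT, hss, Real.exp_le_exp]
    have : a / (2 * U) ≤ a / U := div_le_div_of_nonneg_left ha.le hU (by linarith)
    linarith
  have hs2s : s ^ 2 ≤ s := by nlinarith
  have hTs : 1 / β ≤ s := hTs2.trans hs2s
  have hTpos : 0 < 1 / β := by rw [hT]; exact Real.exp_pos _
  have hlog : a / (4 * U) - Real.log 2 ≤ Real.log (1 / (|s| + 1 / β)) := by
    rw [abs_of_pos hspos]
    have hle : 1 / (2 * s) ≤ 1 / (s + 1 / β) :=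
      one_div_le_one_div_of_le (by positivity) (by linarith)
    have hlog2s : Real.log (1 / (2 * s)) = a / (4 * U) - Real.log 2 := by
      rw [one_div, Real.log_inv, Real.log_mul two_ne_zero hspos.ne', hs, Real.log_exp]
      ring
    rw [← hlog2s]
    exact Real.log_le_log (by positivity) hle
  have e1 : 8 * (c * a / (32 * U) * s ^ 2) - c * Real.log 2 * s ^ 2 ≤
      c * s ^ 2 * Real.log (1 / (|s| + 1 / β)) := by
    have h := mul_le_mul_of_nonneg_left hlog (show 0 ≤ c * s ^ 2 by positivity)
    have e : c * s ^ 2 * (a / (4 * U) - Real.log 2) =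
        8 * (c * a / (32 * U) * s ^ 2) - c * Real.log 2 * s ^ 2 := by
      field_simp
      ring
    linarith
  have e2 : s ^ 2 / g ≤ 2 * (c * a / (32 * U) * s ^ 2) := by
    have h := mul_le_mul_of_nonneg_left hginv hs2.le
    have e : s ^ 2 * (c * a / (16 * U)) = 2 * (c * a / (32 * U) * s ^ 2) := by
      field_simp
      ring
    rw [← div_eq_mul_one_div] at h
    linarith
  have e3 : Real.log 4 / β ≤ Real.log 4 * s ^ 2 := by
    rw [div_eq_mul_one_div]
    exact mul_le_mul_of_nonneg_left hTs2 (Real.log_nonneg (by norm_num))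
  have e4 : (c * Real.log 2 + C + Real.log 4) * s ^ 2 ≤ c * a / (32 * U) * s ^ 2 :=
    mul_le_mul_of_nonneg_right hsmall hs2.le
  have e5 : c * a * s ^ 2 / (8 * U) = 4 * (c * a / (32 * U) * s ^ 2) := by
    field_simp
    ring
  rw [hε, e5]
  nlinarith [e1, e2, e3, e4]

end Bookkeeping

section Rung

/-- **Structural engine of the anchor** (`TwSeededRung` from the NARROWED seeded ensemble
equivalence and sourced condensation), stated with the verbatim bodies of the route declarations
so that this module stays import-cycle-free: hypothesis 1 = `TwSeededEnsembleEquivalence` with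
`β` capped at `e^{a/U}` for every `a > 0` (`U₀ = U₀(δ,a)`, `μ`-window before `a`); hypothesis 2 =
`TwSourcedCondensation`; conclusion = `TwSeededRung`. Proof: rung chord from `g' = 0`, Gibbs lower
bound on the pure sector energy, ensemble equivalence at the probe temperature `β = e^{a/U}`,
approximating Hamiltonian (easy half) at the probe source `s = e^{-a/(4U)}`, condensation;
`K = 16/(ca)`, `c(U,g) = c a s²/(8Ug)`. -/
theorem twSeededRung_structural
    (hEns : ∀ δ ∈ Set.Icc (1/10 : ℝ) (2/5 : ℝ), ∃ μ₁ μ₂ : ℝ, -4 < μ₁ ∧ μ₁ ≤ μ₂ ∧ μ₂ < 0 ∧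
      ∀ a : ℝ, 0 < a → ∃ U₀ : ℝ, 0 < U₀ ∧ ∀ U ∈ Set.Ioc (0 : ℝ) U₀, ∀ g ∈ Set.Ioc (0 : ℝ) (1 / 10),
        ∀ β : ℝ, 1 ≤ β → β ≤ Real.exp (a / U) → ∃ μ ∈ Set.Icc μ₁ μ₂, ∀ ε : ℝ, 0 < ε → ∃ L₀ : ℕ,
          ∀ (L : ℕ) [NeZero L], L₀ ≤ L →
            ((hubbardTorus 2 L 1 U - ((g / (L : ℝ) ^ 2 : ℝ) : ℂ) •
              ((pairField dWaveFormFactor L)ᴴ * pairField dWaveFormFactor L)).minEnergyOn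
                (szSector (Λ := FermionTorus 2 L) (2 * ⌊(1 - δ) * (L : ℝ) ^ 2 / 2⌋₊) 0) /
                  (L : ℝ) ^ 2) +
              (Real.log (Matrix.partitionFn β (hubbardTorusWith 2 L 1 U μ -
                ((g / (L : ℝ) ^ 2 : ℝ) : ℂ) •
                  ((pairField dWaveFormFactor L)ᴴ * pairField dWaveFormFactor L))).re /
                    (β * (L : ℝ) ^ 2)) -
              μ * ((2 * ⌊(1 - δ) * (L : ℝ) ^ 2 / 2⌋₊) : ℝ) / (L : ℝ) ^ 2 ≤ Real.log 4 / β + ε)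
    (hCond : ∀ μ₁ μ₂ : ℝ, -4 < μ₁ → μ₁ ≤ μ₂ → μ₂ < 0 → ∃ U₀ a c C h₀ : ℝ, 0 < U₀ ∧ 0 < a ∧ 0 < c ∧
      0 < C ∧ 0 < h₀ ∧ ∀ U : ℝ, 0 < U → U ≤ U₀ → ∀ β : ℝ, 1 ≤ β → β ≤ Real.exp (a / U) →
        ∀ μ ∈ Set.Icc μ₁ μ₂, ∃ L₀ : ℕ, ∀ (L : ℕ) [NeZero L], L₀ ≤ L → ∀ h : ℝ, |h| ≤ h₀ →
          c * h ^ 2 * Real.log (1 / (|h| + 1 / β)) - C * h ^ 2 ≤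
            (Real.log (Matrix.partitionFn β (dWaveSourceTorus L U μ h)).re / (β * (L : ℝ) ^ 2)) -
              (Real.log (Matrix.partitionFn β (dWaveSourceTorus L U μ 0)).re / (β * (L : ℝ) ^ 2))) :
    ∀ δ ∈ Set.Icc (1/10 : ℝ) (2/5 : ℝ), ∃ U₀ K : ℝ, 0 < U₀ ∧ 0 < K ∧ K * U₀ ≤ 1 / 20 ∧
      ∀ U ∈ Set.Ioc (0 : ℝ) U₀, (∀ g ∈ Set.Icc (K * U) (1 / 10), ∃ c : ℝ, 0 < c ∧ ∃ L₀ : ℕ,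
        ∀ (L : ℕ) [NeZero L], L₀ ≤ L → Even L →
          ∀ (ψ : Fock (Orb (FermionTorus 2 L))), star ψ ⬝ᵥ ψ = 1 →
            IsGroundStateInSector (hubbardTorus 2 L 1 U - ((g / (L : ℝ) ^ 2 : ℝ) : ℂ) •
              ((pairField dWaveFormFactor L)ᴴ * pairField dWaveFormFactor L))
                (2 * ⌊(1 - δ) * (L : ℝ) ^ 2 / 2⌋₊) 0 ψ →
            c * (L : ℝ) ^ 4 ≤
              (expect ((pairField dWaveFormFactor L)ᴴ * pairField dWaveFormFactor L) ψ).re) := by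
  intro δ hδ
  obtain ⟨μ₁, μ₂, hμ₁, hμ₁₂, hμ₂, hEa⟩ := hEns δ hδ
  obtain ⟨U₀c, a, c, C, h₀, hU₀c, ha, hc, hC, hh₀, hCo⟩ := hCond μ₁ μ₂ hμ₁ hμ₁₂ hμ₂
  obtain ⟨U₀e, hU₀e, hE⟩ := hEa a ha
  have hlog2 : 0 < Real.log 2 := Real.log_pos (by norm_num)
  have hlog4 : 0 < Real.log 4 := Real.log_pos (by norm_num)
  have hden : 0 < c * Real.log 2 + C + Real.log 4 := by positivity
  -- constants
  set K : ℝ := 16 / (c * a) with hKdef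
  have hK : 0 < K := by positivity
  set U₁ : ℝ := a * h₀ / 4 with hU₁def
  set U₂ : ℝ := c * a / (32 * (c * Real.log 2 + C + Real.log 4)) with hU₂def
  have hU₁ : 0 < U₁ := by positivity
  have hU₂ : 0 < U₂ := by positivity
  have h20K : 0 < 1 / (20 * K) := by positivity
  set U₀ : ℝ := min (min U₀e U₀c) (min (1 / (20 * K)) (min U₁ U₂)) with hU₀def
  have hU₀ : 0 < U₀ := lt_min (lt_min hU₀e hU₀c) (lt_min h20K (lt_min hU₁ hU₂))
  refine ⟨U₀, K, hU₀, hK, ?_, ?_⟩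
  · have h1 : U₀ ≤ 1 / (20 * K) := (min_le_right _ _).trans (min_le_left _ _)
    calc K * U₀ ≤ K * (1 / (20 * K)) := mul_le_mul_of_nonneg_left h1 hK.le
      _ = 1 / 20 := by field_simp
  intro U hU g hg
  obtain ⟨hU0, hUle⟩ := hU
  obtain ⟨hKU, hg10⟩ := hg
  have hUe : U ≤ U₀e := hUle.trans ((min_le_left _ _).trans (min_le_left _ _))
  have hUc : U ≤ U₀c := hUle.trans ((min_le_left _ _).trans (min_le_right _ _))
  have hUU₁ : U ≤ U₁ :=
    hUle.trans ((min_le_right _ _).trans ((min_le_right _ _).trans (min_le_left _ _)))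
  have hUU₂ : U ≤ U₂ :=
    hUle.trans ((min_le_right _ _).trans ((min_le_right _ _).trans (min_le_right _ _)))
  have hKUpos : 0 < K * U := mul_pos hK hU0
  have hgpos : 0 < g := hKUpos.trans_le hKU
  have hginv : 1 / g ≤ c * a / (16 * U) := by
    have h1 := one_div_le_one_div_of_le hKUpos hKU
    have e : 1 / (K * U) = c * a / (16 * U) := by
      rw [hKdef]
      field_simp
    linarith
  have hsmall : c * Real.log 2 + C + Real.log 4 ≤ c * a / (32 * U) := by
    rw [hU₂def, le_div_iff₀ (by positivity)] at hUU₂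
    rw [le_div_iff₀ (by positivity)]
    linarith
  -- temperature, probe source, allowance
  set β : ℝ := Real.exp (a / U) with hβdef
  have haU : 0 < a / U := div_pos ha hU0
  have hβ1 : 1 ≤ β := Real.one_le_exp haU.le
  have hβpos : 0 < β := Real.exp_pos _
  set s : ℝ := Real.exp (-(a / (4 * U))) with hsdef
  have hspos : 0 < s := Real.exp_pos _
  have hs_le : s ≤ h₀ := by
    have hx : 0 < a / (4 * U) := by positivity
    have h1 : a / (4 * U) + 1 ≤ Real.exp (a / (4 * U)) := Real.add_one_le_exp _
    have h2 : s = (Real.exp (a / (4 * U)))⁻¹ := by rw [hsdef, Real.exp_neg]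
    have h3 : s ≤ (a / (4 * U))⁻¹ := by
      rw [h2]
      exact inv_anti₀ hx (by linarith)
    have h4 : (a / (4 * U))⁻¹ = 4 * U / a := by rw [inv_div]
    have h5 : 4 * U / a ≤ h₀ := by
      rw [div_le_iff₀ ha]
      rw [hU₁def, le_div_iff₀ (by norm_num : (0 : ℝ) < 4)] at hUU₁
      linarith
    linarith [h4 ▸ h3]
  set ε : ℝ := c * a / (32 * U) * s ^ 2 with hεdef
  have hε : 0 < ε := by positivity
  -- the canonical chemical potential and the thresholds
  obtain ⟨μ, hμ, hE'⟩ := hE U ⟨hU0, hUe⟩ g ⟨hgpos, hg10⟩ β hβ1 le_rfl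
  obtain ⟨L₁, hL₁⟩ := hE' ε hε
  obtain ⟨L₂, hL₂⟩ := hCo U hU0 hUc β hβ1 le_rfl μ hμ
  refine ⟨c * a * s ^ 2 / (8 * U) / g, by positivity, max L₁ L₂, ?_⟩
  intro L _ hL _hEven ψ hψ hgs
  have hL1 : L₁ ≤ L := (le_max_left _ _).trans hL
  have hL2 : L₂ ≤ L := (le_max_right _ _).trans hL
  have hLpos : (0 : ℝ) < (L : ℝ) := by exact_mod_cast NeZero.pos L
  -- the rung chord from the pure model
  have hchord := leftChord_le_order (U := U) (g := g) (g' := 0) hgpos hψ hgs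
  -- the Gibbs lower bound on the pure sector energy
  have hn : ⌊(1 - δ) * (L : ℝ) ^ 2 / 2⌋₊ ≤ Fintype.card (FermionTorus 2 L) :=
    le_card_of_mem_szSector L hgs.1 hgs.2.1
  have hlow := twr_sectorEnergy_zero_ge L U μ hβpos hn
  have hn' : μ * ((2 * ⌊(1 - δ) * (L : ℝ) ^ 2 / 2⌋₊ : ℕ) : ℝ) / (L : ℝ) ^ 2 =
      μ * ((2 * ⌊(1 - δ) * (L : ℝ) ^ 2 / 2⌋₊) : ℝ) / (L : ℝ) ^ 2 := by
    push_cast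
    ring
  rw [hn'] at hlow
  -- ensemble equivalence, approximating Hamiltonian (easy half), condensation
  have hup := hL₁ L hL1
  have hahm := twr_sourcedPressure_le_seededPressure_add L U μ hβpos hgpos s
  have hcond := hL₂ L hL2 s (by rw [abs_of_pos hspos]; exact hs_le)
  rw [dWaveSourceTorus_zero] at hcond
  -- margin and bookkeeping
  have hm := twr_margin (g := g) ha hc hU0 hβdef hsdef hginv hsmall hεdef
  exact twr_bookkeeping hLpos hgpos hchord hlow hup hahm hcond hm

end Rung

end Summit.HubbardSuperconductivity.HubbardSuperconductivity.Theorems
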